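import Summits.Ventures.PercRepro.RankLevelSetBasisDeviceB
import Summits.Ventures.PercRepro.RankLevelSetDepCountHeavyWin
import Summits.Ventures.PercRepro.RankLevelSetLevelSixTailLevels
import Summits.Ventures.PercRepro.RankLevelSetLevelSixHeavyCell
import Summits.Ventures.PercRepro.RankLevelSetDepCountHeavySq
import Summits.Ventures.PercRepro.RankLevelSetDepCountHeavyCap
import Summits.Ventures.PercRepro.RankLevelSetCoreCircuitBounds
import Summits.Ventures.PercRepro.RankLevelSetLevelSix
import Summits.Ventures.PercRepro.RankLevelSetPlaneSix
import Summits.Ventures.PercRepro.RankLevelSetCorankFiveCounts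
import Summits.Ventures.PercRepro.RankLevelSetPlaneTen
import Summits.Ventures.PercRepro.RankLevelSetPlaneTenPrime
import Summits.Ventures.PercRepro.RankLevelSetLowRankCount
import Summits.Ventures.PercRepro.RankLevelSetDepCountHeavyU
import Summits.Ventures.PercRepro.RankLevelSetCoreFour
import Summits.Ventures.PercRepro.RankLevelSetFrameLarge
import Summits.Ventures.PercRepro.RankLevelSetFrameQM
import Summits.Ventures.PercRepro.RankLevelSetLevelSixGiant
import Summits.Ventures.PercRepro.RankLevelSetCoreSixColoopFree

/-!
# PercRepro — THE LEVEL-`6` BASIS CELL, PART A: THE FLAT CAPS, THE LEVEL TAIL AND THE LIGHT / HEAVY SPLIT (p8 g10, S3)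

`proofs/SUBCLAIM-S3-p8.md` §3x. On the `e`-free core the sets of rank `≤ i` have at most
`flatCap i = 0, 1, 3, 6, 10, 19, 39` points (`flatCap_bound`, the tree's caps). THE BASIS DEVICE (RankLevelSetBasisDeviceB)
at one level (`ncard_eRk_eq_le_of_cap`) gives the circuit-free tail `#{r ≤ 5} ≤ 1 + n + (4/3)C(n, 2) + (14/5)C(n, 3) +
(64/7)C(n, 4) + (216355/2223)C(n, 5)` (`ncard_eRk_le_five_le_basis`; the constants are the maxima of
`i!·Σ_{l ∈ [i, flatCap i]} C(m, l) / ∏_{k < i} max(m − flatCap k, 1)` over `i ≤ m ≤ flatCap i`), and the rank-`6` sets of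
`≤ c` elements split into the LIGHT ones (closure of `≤ 5 + ν₁` points) and the HEAVY ones (`≥ 6 + ν₁`)
(`ncard_eRk_six_le_light_add_heavy`). Part B (RankLevelSetLevelSixBasisCell) is the cell. Axioms: standard.
-/

open scoped Matroid

namespace PercRepro

namespace ThmN

open Set

variable {α : Type}

/-- The flat caps of the `e`-free core: sets of rank `≤ i` have at most `flatCap i` points
(`0, 1, 3, 6, 10, 19`, and `39` at rank `6` and beyond). -/
def flatCap : ℕ → ℕ
  | 0 => 0
  | 1 => 1
  | 2 => 3
  | 3 => 6
  | 4 => 10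
  | 5 => 19
  | _ => 39

/-- **The flat caps hold on the `e`-free core** for every rank `i ≤ 6`. -/
theorem flatCap_bound (M : Matroid α) [M.Finite]
    (hfree : ∀ e ∈ M.E, ∃ A ⊆ M.E \ {e}, e ∉ M.closure A ∧ e ∉ M.closure ((M.E \ {e}) \ A)) :
    ∀ i : ℕ, i ≤ 6 → ∀ X ⊆ M.E, M.eRk X ≤ (i : ℕ∞) → X.ncard ≤ flatCap i := by
  have hL : ∀ e ∈ M.E, ¬ M.IsLoop e := not_isLoop_of_free M hfree
  intro i hi X hX hr
  rcases Nat.lt_or_ge i 3 with h3 | h3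
  · have := ncard_add_one_le_two_pow_of_eRk_le M hL hfree i X hX hr
    interval_cases i <;> simp [flatCap] at this ⊢ <;> omega
  · rcases Nat.lt_or_ge i 4 with h4 | h4
    · have hi3 : i = 3 := by omega
      subst hi3
      simpa [flatCap] using ncard_le_six_of_eRk_le_three_of_free M hfree hX hr
    · rcases Nat.lt_or_ge i 5 with h5 | h5
      · have hi4 : i = 4 := by omega
        subst hi4
        simpa [flatCap] using ncard_le_ten_of_eRk_le_four_of_free M hfree hX hr
      · rcases Nat.lt_or_ge i 6 with h6 | h6
        · have hi5 : i = 5 := by omega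
          subst hi5
          simpa [flatCap] using ncard_le_nineteen_of_eRk_le_five_of_free M hfree hX hr
        · have hi6 : i = 6 := by omega
          subst hi6
          simpa [flatCap] using ncard_le_thirtynine_of_eRk_le_six_of_free M hfree hX hr

/-- **The device at one level**: if every set of rank `≤ i` has at most `fc` points, the rank-`i` sets number at most
`Gi·C(n, i)` for any `Gi` with `i!·Σ_{l ∈ [i, fc]} C(m, l) ≤ Gi·∏_{k < i} max(m − f k, 1)` on `i ≤ m ≤ fc`. -/
theorem ncard_eRk_eq_le_of_cap (M : Matroid α) [M.Finite] (i fc : ℕ)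
    (hfc : ∀ X ⊆ M.E, M.eRk X ≤ i → X.ncard ≤ fc) (f : ℕ → ℕ)
    (hf : ∀ k < i, ∀ X ⊆ M.E, M.eRk X ≤ k → X.ncard ≤ f k) (Gi : ℚ) (hGi0 : 0 ≤ Gi)
    (hGi : ∀ m, i ≤ m → m ≤ fc →
      ((i.factorial : ℕ) : ℚ) * (∑ l ∈ Finset.Icc i fc, ((m.choose l : ℕ) : ℚ)) ≤
        Gi * ((∏ k ∈ Finset.range i, max (m - f k) 1 : ℕ) : ℚ)) :
    ({X : Set α | X ⊆ M.E ∧ M.eRk X = (i : ℕ∞)}.ncard : ℚ) ≤ Gi * (((M.E.ncard).choose i : ℕ) : ℚ) := by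
  have hsub : {X : Set α | X ⊆ M.E ∧ M.eRk X = (i : ℕ∞)} ⊆
      {B : Set α | B ⊆ M.E ∧ M.eRk B = (i : ℕ∞) ∧ B.ncard ≤ fc ∧ (M.closure B).ncard ≤ fc} := by
    intro X hX
    obtain ⟨hXE, hXr⟩ := hX
    have hcl : (M.closure X).ncard ≤ fc :=
      hfc _ (M.closure_subset_ground X) (by rw [M.eRk_closure_eq, hXr])
    refine ⟨hXE, hXr, ?_, hcl⟩
    have hfin : (M.closure X).Finite := M.ground_finite.subset (M.closure_subset_ground X)
    exact (Set.ncard_le_ncard (M.subset_closure X hXE) hfin).trans hcl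
  have h1 : ({X : Set α | X ⊆ M.E ∧ M.eRk X = (i : ℕ∞)}.ncard : ℚ) ≤
      ({B : Set α | B ⊆ M.E ∧ M.eRk B = (i : ℕ∞) ∧ B.ncard ≤ fc ∧ (M.closure B).ncard ≤ fc}.ncard : ℚ) := by
    have := Set.ncard_le_ncard hsub (M.ground_finite.finite_subsets.subset (fun B hB => hB.1))
    exact_mod_cast this
  exact h1.trans (Matroid.ncard_eRk_eq_ncard_le_closure_le_le i fc fc f hf Gi hGi0 hGi)

set_option maxHeartbeats 4000000 in
/-- **The rank-`≤ 5` tail by the basis device**, with the fixed level constants `1, 1, 4/3, 14/5, 64/7, 216355/2223`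
(the maxima of `i!·Σ_{l ∈ [i, flatCap i]} C(m, l) / ∏_{k < i} max(m − flatCap k, 1)` over `i ≤ m ≤ flatCap i`). -/
theorem ncard_eRk_le_five_le_basis (M : Matroid α) [M.Finite]
    (hfree : ∀ e ∈ M.E, ∃ A ⊆ M.E \ {e}, e ∉ M.closure A ∧ e ∉ M.closure ((M.E \ {e}) \ A)) :
    ({X : Set α | X ⊆ M.E ∧ M.eRk X ≤ ((5 : ℕ) : ℕ∞)}.ncard : ℚ) ≤
      1 + (M.E.ncard : ℚ) + (4 / 3 : ℚ) * (((M.E.ncard).choose 2 : ℕ) : ℚ) +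
        (14 / 5 : ℚ) * (((M.E.ncard).choose 3 : ℕ) : ℚ) + (64 / 7 : ℚ) * (((M.E.ncard).choose 4 : ℕ) : ℚ) +
        (216355 / 2223 : ℚ) * (((M.E.ncard).choose 5 : ℕ) : ℚ) := by
  have hcap := flatCap_bound M hfree
  have hf : ∀ i : ℕ, i ≤ 6 → ∀ k : ℕ, k < i → ∀ X ⊆ M.E, M.eRk X ≤ (k : ℕ∞) → X.ncard ≤ flatCap k :=
    fun i hi k hk => hcap k (by omega)
  -- the levels
  have e0 := ncard_eRk_eq_le_of_cap M 0 (flatCap 0) (hcap 0 (by norm_num)) flatCap (hf 0 (by norm_num)) 1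
    (by norm_num) (by
      intro m h1 h2
      simp only [flatCap] at h2 ⊢
      interval_cases m
      norm_num [flatCap])
  have e1 := ncard_eRk_eq_le_of_cap M 1 (flatCap 1) (hcap 1 (by norm_num)) flatCap (hf 1 (by norm_num)) 1
    (by norm_num) (by
      intro m h1 h2
      simp only [flatCap] at h2 ⊢
      interval_cases m
      norm_num [flatCap])
  have e2 := ncard_eRk_eq_le_of_cap M 2 (flatCap 2) (hcap 2 (by norm_num)) flatCap (hf 2 (by norm_num)) (4 / 3)
    (by norm_num) (by
      intro m h1 h2
      simp only [flatCap] at h2 ⊢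
      rw [show Finset.Icc 2 3 = Finset.Ico 2 4 from (Finset.Ico_succ_right_eq_Icc 2 3).symm,
        Finset.sum_Ico_eq_sum_range]
      interval_cases m <;> norm_num [Finset.sum_range_succ, Finset.prod_range_succ, Nat.choose, flatCap])
  have e3 := ncard_eRk_eq_le_of_cap M 3 (flatCap 3) (hcap 3 (by norm_num)) flatCap (hf 3 (by norm_num)) (14 / 5)
    (by norm_num) (by
      intro m h1 h2
      simp only [flatCap] at h2 ⊢
      rw [show Finset.Icc 3 6 = Finset.Ico 3 7 from (Finset.Ico_succ_right_eq_Icc 3 6).symm,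
        Finset.sum_Ico_eq_sum_range]
      interval_cases m <;> norm_num [Finset.sum_range_succ, Finset.prod_range_succ, Nat.choose, flatCap])
  have e4 := ncard_eRk_eq_le_of_cap M 4 (flatCap 4) (hcap 4 (by norm_num)) flatCap (hf 4 (by norm_num)) (64 / 7)
    (by norm_num) (by
      intro m h1 h2
      simp only [flatCap] at h2 ⊢
      rw [show Finset.Icc 4 10 = Finset.Ico 4 11 from (Finset.Ico_succ_right_eq_Icc 4 10).symm,
        Finset.sum_Ico_eq_sum_range]
      interval_cases m <;> norm_num [Finset.sum_range_succ, Finset.prod_range_succ, Nat.choose, flatCap])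
  have e5 := ncard_eRk_eq_le_of_cap M 5 (flatCap 5) (hcap 5 (by norm_num)) flatCap (hf 5 (by norm_num))
    (216355 / 2223) (by norm_num) (by
      intro m h1 h2
      simp only [flatCap] at h2 ⊢
      rw [show Finset.Icc 5 19 = Finset.Ico 5 20 from (Finset.Ico_succ_right_eq_Icc 5 19).symm,
        Finset.sum_Ico_eq_sum_range]
      interval_cases m <;> norm_num [Finset.sum_range_succ, Finset.prod_range_succ, Nat.choose, flatCap])
  -- the ladder `#{r ≤ q + 1} ≤ #{r ≤ q} + #{r = q + 1}`
  have s0 := ncard_eRk_le_succ_le M 0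
  have s1 := ncard_eRk_le_succ_le M 1
  have s2 := ncard_eRk_le_succ_le M 2
  have s3 := ncard_eRk_le_succ_le M 3
  have s4 := ncard_eRk_le_succ_le M 4
  simp only [Nat.reduceAdd, Nat.cast_ofNat, Nat.cast_zero] at s0 s1 s2 s3 s4
  have hle0 : {X : Set α | X ⊆ M.E ∧ M.eRk X ≤ (0 : ℕ∞)}.ncard ≤ {X : Set α | X ⊆ M.E ∧ M.eRk X = (0 : ℕ∞)}.ncard := by
    apply Set.ncard_le_ncard
    · intro X hX
      exact ⟨hX.1, le_antisymm hX.2 zero_le⟩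
    · exact M.ground_finite.finite_subsets.subset (fun B hB => hB.1)
  have q0 : ({X : Set α | X ⊆ M.E ∧ M.eRk X ≤ (0 : ℕ∞)}.ncard : ℚ) ≤ 1 := by
    have h := (hle0.trans_eq rfl)
    have h' : ({X : Set α | X ⊆ M.E ∧ M.eRk X ≤ (0 : ℕ∞)}.ncard : ℚ) ≤
        ({X : Set α | X ⊆ M.E ∧ M.eRk X = (0 : ℕ∞)}.ncard : ℚ) := by exact_mod_cast h
    simp only [Nat.cast_zero, Nat.choose_zero_right, Nat.cast_one, mul_one] at e0
    exact h'.trans e0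
  simp only [Nat.cast_one, Nat.choose_one_right] at e1
  simp only [Nat.cast_ofNat] at e2 e3 e4 e5
  have c0 : (({X : Set α | X ⊆ M.E ∧ M.eRk X ≤ (1 : ℕ∞)}.ncard : ℕ) : ℚ) ≤
      ({X : Set α | X ⊆ M.E ∧ M.eRk X ≤ (0 : ℕ∞)}.ncard : ℚ) +
        ({X : Set α | X ⊆ M.E ∧ M.eRk X = (1 : ℕ∞)}.ncard : ℚ) := by exact_mod_cast s0
  have c1 : (({X : Set α | X ⊆ M.E ∧ M.eRk X ≤ (2 : ℕ∞)}.ncard : ℕ) : ℚ) ≤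
      ({X : Set α | X ⊆ M.E ∧ M.eRk X ≤ (1 : ℕ∞)}.ncard : ℚ) +
        ({X : Set α | X ⊆ M.E ∧ M.eRk X = (2 : ℕ∞)}.ncard : ℚ) := by exact_mod_cast s1
  have c2 : (({X : Set α | X ⊆ M.E ∧ M.eRk X ≤ (3 : ℕ∞)}.ncard : ℕ) : ℚ) ≤
      ({X : Set α | X ⊆ M.E ∧ M.eRk X ≤ (2 : ℕ∞)}.ncard : ℚ) +
        ({X : Set α | X ⊆ M.E ∧ M.eRk X = (3 : ℕ∞)}.ncard : ℚ) := by exact_mod_cast s2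
  have c3 : (({X : Set α | X ⊆ M.E ∧ M.eRk X ≤ (4 : ℕ∞)}.ncard : ℕ) : ℚ) ≤
      ({X : Set α | X ⊆ M.E ∧ M.eRk X ≤ (3 : ℕ∞)}.ncard : ℚ) +
        ({X : Set α | X ⊆ M.E ∧ M.eRk X = (4 : ℕ∞)}.ncard : ℚ) := by exact_mod_cast s3
  have c4 : (({X : Set α | X ⊆ M.E ∧ M.eRk X ≤ (5 : ℕ∞)}.ncard : ℕ) : ℚ) ≤
      ({X : Set α | X ⊆ M.E ∧ M.eRk X ≤ (4 : ℕ∞)}.ncard : ℚ) +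
        ({X : Set α | X ⊆ M.E ∧ M.eRk X = (5 : ℕ∞)}.ncard : ℚ) := by exact_mod_cast s4
  simp only [Nat.cast_ofNat]
  linarith [q0, c0, c1, c2, c3, c4, e1, e2, e3, e4, e5]

/-- **The light / heavy split of the rank-`6` sets of at most `c` elements** by the size of the closure
(`≤ 5 + ν₁` light, `≥ 6 + ν₁` heavy). -/
theorem ncard_eRk_six_le_light_add_heavy (M : Matroid α) [M.Finite] (ν₁ c : ℕ) :
    {B : Set α | B ⊆ M.E ∧ M.eRk B = (6 : ℕ) ∧ B.ncard ≤ c}.ncard ≤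
      {B : Set α | B ⊆ M.E ∧ M.eRk B = (6 : ℕ) ∧ B.ncard ≤ c ∧ (M.closure B).ncard ≤ 5 + ν₁}.ncard +
        {B : Set α | B ⊆ M.E ∧ M.eRk B = (6 : ℕ) ∧ 6 + ν₁ ≤ (M.closure B).ncard ∧ B.ncard ≤ c}.ncard := by
  have hfin : ∀ S : Set (Set α), S ⊆ {B : Set α | B ⊆ M.E} → S.Finite :=
    fun S hS => M.ground_finite.finite_subsets.subset hS
  have hsub : {B : Set α | B ⊆ M.E ∧ M.eRk B = (6 : ℕ) ∧ B.ncard ≤ c} ⊆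
      {B : Set α | B ⊆ M.E ∧ M.eRk B = (6 : ℕ) ∧ B.ncard ≤ c ∧ (M.closure B).ncard ≤ 5 + ν₁} ∪
        {B : Set α | B ⊆ M.E ∧ M.eRk B = (6 : ℕ) ∧ 6 + ν₁ ≤ (M.closure B).ncard ∧ B.ncard ≤ c} := by
    intro B hB
    obtain ⟨hBE, hBr, hBc⟩ := hB
    rcases Nat.lt_or_ge (M.closure B).ncard (6 + ν₁) with h | h
    · exact Or.inl ⟨hBE, hBr, hBc, by omega⟩
    · exact Or.inr ⟨hBE, hBr, h, hBc⟩
  calc {B : Set α | B ⊆ M.E ∧ M.eRk B = (6 : ℕ) ∧ B.ncard ≤ c}.ncard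
      ≤ ({B : Set α | B ⊆ M.E ∧ M.eRk B = (6 : ℕ) ∧ B.ncard ≤ c ∧ (M.closure B).ncard ≤ 5 + ν₁} ∪
          {B : Set α | B ⊆ M.E ∧ M.eRk B = (6 : ℕ) ∧ 6 + ν₁ ≤ (M.closure B).ncard ∧ B.ncard ≤ c}).ncard :=
        Set.ncard_le_ncard hsub ((hfin _ (fun B hB => hB.1)).union (hfin _ (fun B hB => hB.1)))
    _ ≤ _ := Set.ncard_union_le _ _

end ThmN

end PercRepro
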